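import Literature.NumberTheory.LFunctions.EulerMaclaurinZetaHigher
import Mathlib.NumberTheory.LSeries.HurwitzZeta
import HarnessLib

/-!
# Euler–Maclaurin summation for the Hurwitz zeta function `ζ(s, a)` on `Re s > 0`

Topic `Literature/NumberTheory/LFunctions` (namespace `Literature.NumberTheory.LFunctions`, grouping
sub-namespace `HurwitzEM` for the auxiliary integrals). Everything in this file is PROVED (no named
fact). The companion of the tree's `EulerMaclaurinZeta.lean` / `EulerMaclaurinZetaHigher.lean`
(Edwards, *Riemann's Zeta Function*, §6.4, for `ζ(s)`), for Mathlib's Hurwitz zeta function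
`HurwitzZeta.hurwitzZeta a s` (`= Σ_{n ≥ 0} (n + a)^{-s}` for `Re s > 1`, `0 ≤ a ≤ 1`,
`HurwitzZeta.hasSum_hurwitzZeta_of_one_lt_re`): for `Re s > 0`, `s ≠ 1`, `N ≥ 1`, `0 ≤ a ≤ 1` and
every order `ν`,

  `ζ(s, a) = Σ_{n<N} (n+a)^{-s} + (N+a)^{1-s}/(s-1) + ½ (N+a)^{-s}`
  `        + Σ_{k=1}^{ν} (B_{2k}/(2k)!) s(s+1)⋯(s+2k-2) (N+a)^{-(s+2k-1)} + R_ν(s, a)`,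
  `R_ν(s, a) = -(s(s+1)⋯(s+2ν)/(2ν+1)!) ∫_N^∞ B̄_{2ν+1}(x) (x+a)^{-(s+2ν+1)} dx`

(`B̄_k` the periodic Bernoulli functions `Literature.NumberTheory.LFunctions.bernoulliPer`), i.e.
Edwards' formula with `n` replaced by `n + a`, together with the explicit remainder bound

  `‖R_ν(s, a)‖ ≤ ‖s(s+1)⋯(s+2ν)‖ · (π²/3)(2π)^{-(2ν+1)} · N^{-(Re s + 2ν)}/(Re s + 2ν)`  (`ν ≥ 1`)

— the SAME majorant as the tree's `norm_emRemHigher_le` for `ζ` (we bound `(x+a)^{-σ} ≤ x^{-σ}`), so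
that the certified evaluator built on this file (`HurwitzCertifiedEvaluation.lean`) can reuse the
remainder radius of `ZetaCertifiedEvaluation.lean` verbatim. This is the classical way to compute
Dirichlet `L`-functions, `L(s, χ) = q^{-s} Σ_{j mod q} χ(j) ζ(s, j/q)` (Mathlib's `ZMod.LFunction`).

## Method (all proved here)

* §1 The remainder integrals `J_k(N, a, s) = ∫_N^∞ B̄_k(x) (x+a)^{-(s+k)} dx`
  (`HurwitzEM.integral`): absolute convergence for `Re s > 1 − k` (majorant `β x^{-(Re s + k)}`),
  the bound `‖J_k‖ ≤ β N^{-(Re s+k-1)}/(Re s+k-1)`, and holomorphy in `s`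
  (`HurwitzEM.hasDerivAt_logIntegral`, differentiation under the integral sign exactly as in
  `hasDerivAt_bernoulliLogIntegral`).
* §2 Integration by parts on unit intervals and the recursion
  `J_k = -B_{k+1}(N+a)^{-(s+k)}/(k+1) + ((s+k)/(k+1)) J_{k+1}` (`HurwitzEM.integral_eq_succ`).
* §3 Order zero on `Re s > 1` from the Dirichlet series: on `[n, n+1)` one has `B̄₁(x) = x − n − ½`,
  so `(n+a)^{-s} = [(n+1+a)^{1-s} − (n+a)^{1-s}]/(1−s) + ½[(n+a)^{-s} − (n+1+a)^{-s}] − s ∫_n^{n+1} B̄₁ (x+a)^{-s-1}`;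
  summing `n = N, …, M−1` and letting `M → ∞` gives the formula
  (`hurwitzZeta_eq_eulerMaclaurin₀_of_one_lt_re`).
* §4 Continuation to `Re s > 0` by the identity theorem applied to the ENTIRE function
  `s ↦ (s−1)·(ζ(s,a) − 1/((s−1)Γ_ℝ(s))) + 1/Γ_ℝ(s)` (Mathlib's
  `HurwitzZeta.differentiableAt_hurwitzZeta_sub_one_div`), which equals `(s−1)ζ(s,a)` off `s = 1`
  (`hurwitzZeta_eq_eulerMaclaurin₀`).
* §5 Order `ν` (`hurwitzEmTerm`, `hurwitzEmRem`, `hurwitzZeta_eq_eulerMaclaurin_of_re_pos`) and the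
  remainder bounds `norm_hurwitzEmRem_le`, `norm_hurwitzEmRem_le_rat` (the rational majorant of
  `norm_emRemHigher_le_rat`).

What is NOT here: the order-`ν` formula on `Re s > 1 − 2ν` (only `Re s > 0` is continued), the
`s`-derivatives of the formula, and any numerics (see `HurwitzCertifiedEvaluation.lean`).

## References

* H. M. Edwards, *Riemann's Zeta Function*, Academic Press 1974, §6.4 eq. (1) and the remainder
  estimate following it (stated for `ζ`; the Hurwitz case is the same computation with `n ↦ n + a`).
  [Edwards1974]
* H. L. Montgomery, R. C. Vaughan, *Multiplicative Number Theory I*, CUP 2007, §10.1 (Dirichlet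
  `L`-functions through Hurwitz zeta functions). [MontgomeryVaughan2007]
-/

noncomputable section

open Complex Filter Topology Set MeasureTheory intervalIntegral
open scoped Interval

namespace Literature.NumberTheory.LFunctions

namespace HurwitzEM

/-! ## §1 The remainder integrals `∫_N^∞ B̄_k(x) (x+a)^{-(s+k)} (log (x+a))^j dx` -/

/-- The integrand `B̄_k(x) · (x+a)^{-(s+k)} · (log (x+a))^j`. [folklore] -/
def logIntegrand (k j : ℕ) (a : ℝ) (s : ℂ) (x : ℝ) : ℂ :=
  (bernoulliPer k x : ℂ) * ((((x + a : ℝ)) : ℂ) ^ (-(s + k)) * ((Real.log (x + a) : ℝ) : ℂ) ^ j)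

/-- `∫_N^∞ B̄_k(x) (x+a)^{-(s+k)} (log (x+a))^j dx` (`j`-th `s`-derivative, up to sign, of the
Euler–Maclaurin remainder integral of the Hurwitz zeta function). [cite: Edwards1974, §6.4 eq. (1)] -/
def logIntegral (k N j : ℕ) (a : ℝ) (s : ℂ) : ℂ :=
  ∫ x in Ioi (N : ℝ), logIntegrand k j a s x

/-- `J_k(N, a, s) = ∫_N^∞ B̄_k(x) (x+a)^{-(s+k)} dx`, the Euler–Maclaurin remainder integral for
`ζ(s, a)` (Edwards §6.4 (1) with `k = 2ν+1` and `x ↦ x + a`). [cite: Edwards1974, §6.4 eq. (1)] -/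
def integral (k N : ℕ) (a : ℝ) (s : ℂ) : ℂ :=
  ∫ x in Ioi (N : ℝ), (bernoulliPer k x : ℂ) * (((x + a : ℝ)) : ℂ) ^ (-(s + k))

/-- `integral = logIntegral` with `j = 0`. [folklore] -/
private lemma logIntegral_zero (k N : ℕ) (a : ℝ) (s : ℂ) : logIntegral k N 0 a s = integral k N a s := by
  simp [logIntegral, integral, logIntegrand]

/-- Measurability of the integrand. [folklore] -/
private lemma measurable_logIntegrand (k j : ℕ) (a : ℝ) (s : ℂ) : Measurable (logIntegrand k j a s) := by
  unfold logIntegrand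
  refine (measurable_ofReal.comp (measurable_bernoulliPer k)).mul ?_
  refine Measurable.mul ?_ ?_
  · exact (measurable_ofReal.comp (measurable_id.add_const a)).pow_const _
  · exact ((measurable_ofReal.comp (Real.measurable_log.comp (measurable_id.add_const a))).pow_const _)

/-- Norm of the integrand for `x ≥ 1`, `a ≥ 0`:
`|B̄_k(x)| · (x+a)^{-(Re s + k)} · (log (x+a))^j`. [folklore] -/
private lemma norm_logIntegrand {k j : ℕ} {a : ℝ} (ha : 0 ≤ a) {s : ℂ} {x : ℝ} (hx : 1 ≤ x) :
    ‖logIntegrand k j a s x‖ =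
      |bernoulliPer k x| * ((x + a) ^ (-(s.re + k)) * Real.log (x + a) ^ j) := by
  have hx0 : 0 < x + a := by linarith
  have hx1 : 1 ≤ x + a := by linarith
  unfold logIntegrand
  rw [norm_mul, norm_mul, norm_pow, Complex.norm_real, Complex.norm_real, Real.norm_eq_abs,
    Real.norm_eq_abs, abs_of_nonneg (Real.log_nonneg hx1), norm_cpow_eq_rpow_re_of_pos hx0]
  simp

/-- Pointwise bound `‖integrand‖ ≤ β x^{-(σ+k)} (log (x+a))^j` for `x ≥ 1`, `a ≥ 0`, `σ + k ≥ 0`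
(`(x+a)^{-(σ+k)} ≤ x^{-(σ+k)}`). [folklore] -/
private lemma norm_logIntegrand_le {k j : ℕ} {a : ℝ} (ha : 0 ≤ a) {β : ℝ} (hβ : ∀ x, |bernoulliPer k x| ≤ β)
    {s : ℂ} (hsk : 0 ≤ s.re + k) {x : ℝ} (hx : 1 ≤ x) :
    ‖logIntegrand k j a s x‖ ≤ β * (x ^ (-(s.re + k)) * Real.log (x + a) ^ j) := by
  rw [norm_logIntegrand ha hx]
  have hx0 : 0 < x := by linarith
  have hx1 : 1 ≤ x + a := by linarith
  have hlog : 0 ≤ Real.log (x + a) ^ j := pow_nonneg (Real.log_nonneg hx1) _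
  have hpow : (x + a) ^ (-(s.re + k)) ≤ x ^ (-(s.re + k)) :=
    Real.rpow_le_rpow_of_nonpos hx0 (by linarith) (by linarith)
  have hβ0 : 0 ≤ β := le_trans (abs_nonneg _) (hβ 0)
  calc |bernoulliPer k x| * ((x + a) ^ (-(s.re + k)) * Real.log (x + a) ^ j)
      ≤ β * ((x + a) ^ (-(s.re + k)) * Real.log (x + a) ^ j) :=
        mul_le_mul_of_nonneg_right (hβ x) (mul_nonneg (Real.rpow_nonneg (by linarith) _) hlog)
    _ ≤ β * (x ^ (-(s.re + k)) * Real.log (x + a) ^ j) := by gcongr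

/-- `(log (x+a))^j ≤ (2(j+1)/ε)^j x^ε` for `x ≥ 1`, `0 ≤ a ≤ 1`, `ε > 0`
(`log (x+a) ≤ log (2x) ≤ 2 log x'`-free form: `(log y)^j ≤ ((j+1)/ε)^j y^ε` at `y = x + a ≤ 2x` and
`(2x)^ε ≤ 2 x^ε` for `ε ≤ 1`; we only need some polynomially-growing majorant, and use
`y^ε ≤ (2x)^ε = 2^ε x^ε ≤ 2^1 … ` only through `pow_log_le_rpow` at `y` and `y ≤ 2x`). [folklore] -/
private lemma pow_log_add_le_rpow {x a ε : ℝ} (hx : 1 ≤ x) (ha : 0 ≤ a) (ha1 : a ≤ 1) (hε : 0 < ε)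
    (hε1 : ε ≤ 1) (j : ℕ) :
    Real.log (x + a) ^ j ≤ (2 * (((j + 1) / ε) ^ j)) * x ^ ε := by
  have hx0 : 0 < x := by linarith
  have hy1 : 1 ≤ x + a := by linarith
  have h1 := pow_log_le_rpow hy1 hε j
  have h2 : (x + a) ^ ε ≤ (2 * x) ^ ε :=
    Real.rpow_le_rpow (by linarith) (by linarith) hε.le
  have h3 : (2 * x) ^ ε = 2 ^ ε * x ^ ε := Real.mul_rpow (by norm_num) hx0.le
  have h4 : (2 : ℝ) ^ ε ≤ 2 := by
    calc (2 : ℝ) ^ ε ≤ 2 ^ (1 : ℝ) := Real.rpow_le_rpow_of_exponent_le (by norm_num) hε1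
      _ = 2 := Real.rpow_one 2
  have hc : 0 ≤ ((j + 1) / ε) ^ j := by positivity
  calc Real.log (x + a) ^ j ≤ ((j + 1) / ε) ^ j * (x + a) ^ ε := h1
    _ ≤ ((j + 1) / ε) ^ j * (2 ^ ε * x ^ ε) := by rw [← h3]; gcongr
    _ ≤ ((j + 1) / ε) ^ j * (2 * x ^ ε) := by gcongr
    _ = (2 * (((j + 1) / ε) ^ j)) * x ^ ε := by ring

/-- The remainder integrand is integrable on `(N, ∞)` for `Re s > 1 - k`, `N ≥ 1`, `0 ≤ a ≤ 1`.
[folklore] -/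
private lemma integrableOn_logIntegrand {k j N : ℕ} (hN : 1 ≤ N) {a : ℝ} (ha : 0 ≤ a) (ha1 : a ≤ 1)
    {s : ℂ} (hs : 1 - k < s.re) :
    IntegrableOn (logIntegrand k j a s) (Ioi (N : ℝ)) := by
  obtain ⟨β, hβ0, hβ⟩ := exists_bound_bernoulliPer k
  set ε : ℝ := min ((s.re + k - 1) / 2) 1 with hε
  have hε0 : 0 < ε := by
    rw [hε]; exact lt_min (by linarith) one_pos
  have hε1 : ε ≤ 1 := min_le_right _ _
  have hεle : ε ≤ (s.re + k - 1) / 2 := min_le_left _ _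
  have hN0 : (0 : ℝ) < N := by exact_mod_cast hN
  have hint : IntegrableOn
      (fun x : ℝ ↦ β * (2 * ((j + 1) / ε) ^ j) * x ^ (-(s.re + k) + ε)) (Ioi (N : ℝ)) := by
    refine (integrableOn_Ioi_rpow_of_lt ?_ hN0).const_mul _
    linarith
  refine Integrable.mono' hint (measurable_logIntegrand k j a s).aestronglyMeasurable ?_
  rw [ae_restrict_iff' measurableSet_Ioi]
  refine Eventually.of_forall fun x (hx : (N : ℝ) < x) ↦ ?_
  have hx1 : 1 ≤ x := le_trans (by exact_mod_cast hN) hx.le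
  have hx0 : 0 < x := by linarith
  calc ‖logIntegrand k j a s x‖ ≤ β * (x ^ (-(s.re + k)) * Real.log (x + a) ^ j) :=
        norm_logIntegrand_le ha hβ (by linarith) hx1
    _ ≤ β * (x ^ (-(s.re + k)) * ((2 * ((j + 1) / ε) ^ j) * x ^ ε)) := by
        gcongr
        exact pow_log_add_le_rpow hx1 ha ha1 hε0 hε1 j
    _ = β * (2 * ((j + 1) / ε) ^ j) * x ^ (-(s.re + k) + ε) := by
        rw [Real.rpow_add hx0]; ring

/-- Integrability of `B̄_k(x) (x+a)^{-(s+k)}` on `(N, ∞)` (`Re s > 1 - k`, `N ≥ 1`, `0 ≤ a ≤ 1`).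
[folklore] -/
private lemma integrableOn_integrand {k N : ℕ} (hN : 1 ≤ N) {a : ℝ} (ha : 0 ≤ a) (ha1 : a ≤ 1) {s : ℂ}
    (hs : 1 - k < s.re) :
    IntegrableOn (fun x : ℝ ↦ (bernoulliPer k x : ℂ) * (((x + a : ℝ)) : ℂ) ^ (-(s + k)))
      (Ioi (N : ℝ)) := by
  refine (integrableOn_logIntegrand (j := 0) hN ha ha1 hs).congr_fun (fun x _ ↦ ?_) measurableSet_Ioi
  simp [logIntegrand]

/-- **Remainder estimate:** `‖∫_N^∞ B̄_k (x+a)^{-(s+k)} dx‖ ≤ β N^{-σ'}/σ'` with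
`σ' = Re s + k - 1 > 0`, `|B̄_k| ≤ β`, `0 ≤ a` (the majorant does not see `a`).
[cite: Edwards1974, §6.4 (estimate after eq. (1))] -/
theorem norm_integral_le {k N : ℕ} {β : ℝ} (hβ : ∀ x, |bernoulliPer k x| ≤ β) (hN : 1 ≤ N)
    {a : ℝ} (ha : 0 ≤ a) {s : ℂ} (hs : 1 - (k : ℝ) < s.re) :
    ‖integral k N a s‖ ≤ β * ((N : ℝ) ^ (-(s.re + k - 1)) / (s.re + k - 1)) := by
  have hσ : 0 < s.re + k - 1 := by linarith
  have hN0 : (0 : ℝ) < N := by exact_mod_cast hN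
  have hint : IntegrableOn (fun x : ℝ ↦ β * x ^ (-(s.re + k - 1) - 1)) (Ioi (N : ℝ)) :=
    (integrableOn_Ioi_rpow_of_lt (by linarith) hN0).const_mul _
  have hae : ∀ᵐ x ∂(volume.restrict (Ioi (N : ℝ))),
      ‖(bernoulliPer k x : ℂ) * (((x + a : ℝ)) : ℂ) ^ (-(s + k))‖ ≤
        β * x ^ (-(s.re + k - 1) - 1) := by
    rw [ae_restrict_iff' measurableSet_Ioi]
    refine Eventually.of_forall fun x (hx : (N : ℝ) < x) ↦ ?_
    have hx1 : 1 ≤ x := le_trans (by exact_mod_cast hN) hx.le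
    have h := norm_logIntegrand_le (j := 0) ha hβ (s := s) (by linarith) hx1
    simp only [logIntegrand, pow_zero, mul_one] at h
    rw [show -(s.re + k - 1) - 1 = -(s.re + k) by ring]
    exact h
  unfold integral
  refine (norm_integral_le_of_norm_le hint hae).trans (le_of_eq ?_)
  rw [MeasureTheory.integral_const_mul, integral_Ioi_rpow_neg_succ hσ hN0]

/-- **The remainder integrals are holomorphic in `s`** on `Re s > 1 - k` (`N ≥ 1`, `0 ≤ a ≤ 1`):
`d/ds ∫_N^∞ B̄_k (x+a)^{-(s+k)} (log (x+a))^j dx = -∫_N^∞ B̄_k (x+a)^{-(s+k)} (log (x+a))^{j+1} dx`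
(differentiation under the integral sign, dominated on `|s − s₀| < σ₀'/2` by `C x^{-1-σ₀'/4}`).
[cite: Edwards1974, §6.4 (text after eq. (1))] -/
theorem hasDerivAt_logIntegral {k N j : ℕ} (hN : 1 ≤ N) {a : ℝ} (ha : 0 ≤ a) (ha1 : a ≤ 1)
    {s₀ : ℂ} (hs₀ : 1 - (k : ℝ) < s₀.re) :
    HasDerivAt (logIntegral k N j a) (-logIntegral k N (j + 1) a s₀) s₀ := by
  obtain ⟨β, hβ0, hβ⟩ := exists_bound_bernoulliPer k
  set a₀ : ℝ := s₀.re + k - 1 with ha₀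
  have ha₀pos : 0 < a₀ := by rw [ha₀]; linarith
  set δ : ℝ := min (a₀ / 2) 1 with hδ
  have hδ0 : 0 < δ := by rw [hδ]; exact lt_min (by positivity) one_pos
  have hδle : δ ≤ a₀ / 2 := min_le_left _ _
  have hball : Metric.ball s₀ δ ∈ 𝓝 s₀ := Metric.ball_mem_nhds _ hδ0
  have hre : ∀ s ∈ Metric.ball s₀ δ, s₀.re - δ < s.re := by
    intro s hs
    have h1 : |(s - s₀).re| ≤ ‖s - s₀‖ := abs_re_le_norm _
    have h2 : ‖s - s₀‖ < δ := by simpa [dist_eq_norm] using hs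
    have h3 : |s.re - s₀.re| < δ := by simpa using h1.trans_lt h2
    linarith [(abs_lt.mp h3).1]
  set ε : ℝ := δ / 2 with hε
  have hε0 : 0 < ε := by positivity
  have hε1 : ε ≤ 1 := by
    have : δ ≤ 1 := min_le_right _ _
    rw [hε]; linarith
  set C : ℝ := β * (2 * ((((j + 1 : ℕ) : ℝ) + 1) / ε) ^ (j + 1)) with hC
  set bound : ℝ → ℝ := fun x ↦ C * x ^ (-(s₀.re + k) + δ + ε) with hbound
  have hN0 : (0 : ℝ) < N := by exact_mod_cast hN
  have key := hasDerivAt_integral_of_dominated_loc_of_deriv_le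
    (μ := volume.restrict (Ioi (N : ℝ))) (F := fun s x ↦ logIntegrand k j a s x)
    (F' := fun s x ↦ -logIntegrand k (j + 1) a s x) (x₀ := s₀) (bound := bound) hball
    ?meas ?int ?meas' ?bd ?bdint ?diff
  · have h2 := key.2
    rw [MeasureTheory.integral_neg] at h2
    exact h2
  case meas =>
    exact Eventually.of_forall fun s ↦ (measurable_logIntegrand k j a s).aestronglyMeasurable
  case int => exact integrableOn_logIntegrand hN ha ha1 (by simpa using hs₀)
  case meas' => exact ((measurable_logIntegrand k (j + 1) a s₀).neg).aestronglyMeasurable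
  case bd =>
    rw [ae_restrict_iff' measurableSet_Ioi]
    refine Eventually.of_forall fun x (hx : (N : ℝ) < x) s hs ↦ ?_
    have hx1 : 1 ≤ x := le_trans (by exact_mod_cast hN) hx.le
    have hx0 : 0 < x := by linarith
    have hsre := hre s hs
    have hsk : 0 ≤ s.re + k := by
      have : δ ≤ a₀ / 2 := hδle
      rw [ha₀] at this
      linarith
    rw [norm_neg]
    calc ‖logIntegrand k (j + 1) a s x‖
        ≤ β * (x ^ (-(s.re + k)) * Real.log (x + a) ^ (j + 1)) := norm_logIntegrand_le ha hβ hsk hx1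
      _ ≤ β * (x ^ (-(s₀.re + k) + δ) *
            ((2 * ((((j + 1 : ℕ) : ℝ) + 1) / ε) ^ (j + 1)) * x ^ ε)) := by
          have hlog0 : 0 ≤ Real.log (x + a) ^ (j + 1) :=
            pow_nonneg (Real.log_nonneg (by linarith)) _
          have hA : x ^ (-(s.re + k)) ≤ x ^ (-(s₀.re + k) + δ) :=
            Real.rpow_le_rpow_of_exponent_le hx1 (by linarith)
          have hB : Real.log (x + a) ^ (j + 1) ≤
              (2 * ((((j + 1 : ℕ) : ℝ) + 1) / ε) ^ (j + 1)) * x ^ ε := by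
            have := pow_log_add_le_rpow hx1 ha ha1 hε0 hε1 (j + 1)
            push_cast at this ⊢
            exact this
          have hx0' : 0 ≤ x ^ (-(s₀.re + k) + δ) := Real.rpow_nonneg hx0.le _
          exact mul_le_mul_of_nonneg_left (mul_le_mul hA hB hlog0 hx0') hβ0.le
      _ = bound x := by
          simp only [hbound, hC]
          have hxe : x ^ (-(s₀.re + k) + δ) * x ^ ε = x ^ (-(s₀.re + k) + δ + ε) := by
            rw [← Real.rpow_add hx0]
          rw [← hxe]
          ring
  case bdint =>
    refine (integrableOn_Ioi_rpow_of_lt ?_ hN0).const_mul _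
    have h1 : s₀.re + k = a₀ + 1 := by rw [ha₀]; ring
    rw [h1, hε]
    linarith
  case diff =>
    rw [ae_restrict_iff' measurableSet_Ioi]
    refine Eventually.of_forall fun x (hx : (N : ℝ) < x) s _ ↦ ?_
    have hx0 : 0 < x + a := by linarith [lt_trans hN0 hx]
    have hx' : (((x + a : ℝ)) : ℂ) ≠ 0 := ofReal_ne_zero.mpr hx0.ne'
    have h1 : HasDerivAt (fun s : ℂ ↦ -(s + k)) (-1) s := ((hasDerivAt_id s).add_const (k : ℂ)).neg
    have h2 := ((h1.const_cpow (c := (((x + a : ℝ)) : ℂ)) (Or.inl hx')).mul_const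
      (((Real.log (x + a) : ℝ) : ℂ) ^ j)).const_mul ((bernoulliPer k x : ℝ) : ℂ)
    have hlog : Complex.log (((x + a : ℝ)) : ℂ) = ((Real.log (x + a) : ℝ) : ℂ) :=
      (Complex.ofReal_log hx0.le).symm
    refine h2.congr_deriv ?_
    simp only [logIntegrand, hlog, pow_succ]
    ring

/-- The remainder integral `J_k(N, a, ·)` is holomorphic on `Re s > 1 - k` (Edwards: the formula
"remains valid as long as the integral converges"). [cite: Edwards1974, §6.4 (text after eq. (1))] -/
theorem differentiableOn_integral {k N : ℕ} (hN : 1 ≤ N) {a : ℝ} (ha : 0 ≤ a) (ha1 : a ≤ 1) :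
    DifferentiableOn ℂ (integral k N a) {s : ℂ | 1 - (k : ℝ) < s.re} := by
  intro s hs
  have h := (hasDerivAt_logIntegral (j := 0) hN ha ha1 hs).differentiableAt.differentiableWithinAt
    (s := {s : ℂ | 1 - (k : ℝ) < s.re})
  have heq : logIntegral k N 0 a = integral k N a := funext fun s ↦ logIntegral_zero k N a s
  rw [heq] at h
  exact h


/-! ## §2 Integration by parts on unit intervals and the recursion `J_k ↦ J_{k+1}` -/

/-- `x ↦ (x + a)^w` (real `x`, complex power of the positive real `x + a`) has derivative
`w (x+a)^{w-1}`. [folklore] -/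
private lemma hasDerivAt_ofReal_add_cpow {x a : ℝ} (hx : 0 < x + a) (w : ℂ) :
    HasDerivAt (fun y : ℝ ↦ (((y + a : ℝ)) : ℂ) ^ w) (w * (((x + a : ℝ)) : ℂ) ^ (w - 1)) x := by
  exact (hasDerivAt_ofReal_cpow hx w).comp_add_const x a

/-- **Integration by parts on `[n, n+1]`** (`n ≥ 1`, `k ≥ 1`, `a ≥ 0`):
`∫ₙ^{n+1} B̄_k (x+a)^{-(s+k)} = (B_{k+1}/(k+1)) ((n+1+a)^{-(s+k)} - (n+a)^{-(s+k)})`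
`  + ((s+k)/(k+1)) ∫ₙ^{n+1} B̄_{k+1} (x+a)^{-(s+k+1)}` (`B_{k+1}' = (k+1) B_k`,
`B_{k+1}(1) = B_{k+1}(0) = B_{k+1}`). [cite: Edwards1974, §6.4 eq. (1)] -/
theorem intervalIntegral_unit {k n : ℕ} (hk : 1 ≤ k) (hn : 1 ≤ n) {a : ℝ} (ha : 0 ≤ a) (s : ℂ) :
    ∫ x in (n : ℝ)..(n + 1), (bernoulliPer k x : ℂ) * (((x + a : ℝ)) : ℂ) ^ (-(s + k)) =
      (bernoulli (k + 1) : ℂ) / (k + 1) *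
          ((((n + 1 + a : ℝ)) : ℂ) ^ (-(s + k)) - (((n + a : ℝ)) : ℂ) ^ (-(s + k))) +
        (s + k) / (k + 1) *
          ∫ x in (n : ℝ)..(n + 1), (bernoulliPer (k + 1) x : ℂ) *
            (((x + a : ℝ)) : ℂ) ^ (-(s + k + 1)) := by
  have hn0 : (0 : ℝ) < n := by exact_mod_cast hn
  have hk1 : (k : ℂ) + 1 ≠ 0 := by exact_mod_cast Nat.succ_ne_zero k
  -- the smooth functions on `[n, n+1]`
  set u : ℝ → ℂ := fun x ↦ (bernoulliFun (k + 1) (x - n) : ℂ) / (k + 1) with hu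
  set u' : ℝ → ℂ := fun x ↦ (bernoulliFun k (x - n) : ℂ) with hu'
  set v : ℝ → ℂ := fun x ↦ (((x + a : ℝ)) : ℂ) ^ (-(s + k)) with hv
  set v' : ℝ → ℂ := fun x ↦ -(s + k) * (((x + a : ℝ)) : ℂ) ^ (-(s + k + 1)) with hv'
  have hle : (n : ℝ) ≤ n + 1 := by linarith
  have hderu : ∀ x ∈ uIcc (n : ℝ) (n + 1), HasDerivAt u (u' x) x := by
    intro x _
    have h1 : HasDerivAt (fun x : ℝ ↦ x - n) 1 x := (hasDerivAt_id x).sub_const _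
    have h2 := (hasDerivAt_bernoulliFun (k + 1) (x - n)).comp x h1
    have h3 := (h2.ofReal_comp).div_const ((k : ℂ) + 1)
    refine h3.congr_deriv ?_
    simp only [hu', Nat.add_sub_cancel, mul_one]
    push_cast
    field_simp
  have hderv : ∀ x ∈ uIcc (n : ℝ) (n + 1), HasDerivAt v (v' x) x := by
    intro x hx
    rw [uIcc_of_le hle] at hx
    have hx0 : 0 < x + a := by linarith [lt_of_lt_of_le hn0 hx.1]
    refine (hasDerivAt_ofReal_add_cpow hx0 _).congr_deriv ?_
    simp only [hv']
    congr 1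
    ring
  have hcu' : Continuous u' := by
    simp only [hu']
    exact continuous_ofReal.comp ((continuous_bernoulliFun (k := k)).comp (continuous_sub_right _))
  have hcv' : ContinuousOn v' (uIcc (n : ℝ) (n + 1)) := by
    intro x hx
    rw [uIcc_of_le hle] at hx
    have hx0 : 0 < x + a := by linarith [lt_of_lt_of_le hn0 hx.1]
    exact (continuousAt_const.mul (hasDerivAt_ofReal_add_cpow hx0 _).continuousAt).continuousWithinAt
  have hIBP := intervalIntegral.integral_deriv_mul_eq_sub hderu hderv
    (hcu'.intervalIntegrable _ _) hcv'.intervalIntegrable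
  -- values at the endpoints
  have hu1 : u ((n : ℝ) + 1) = (bernoulli (k + 1) : ℂ) / (k + 1) := by
    simp only [hu, add_sub_cancel_left]
    rw [bernoulliFun_endpoints_eq_of_ne_one (by omega), bernoulliFun_eval_zero]
    push_cast; rfl
  have hu0 : u (n : ℝ) = (bernoulli (k + 1) : ℂ) / (k + 1) := by
    simp only [hu, sub_self, bernoulliFun_eval_zero]
    push_cast; rfl
  -- split the IBP identity
  have hint1 : IntervalIntegrable (fun x ↦ u' x * v x) volume (n : ℝ) (n + 1) :=
    (hcu'.continuousOn.mul (fun x hx ↦ (hderv x hx).continuousAt.continuousWithinAt)).intervalIntegrable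
  have hint2 : IntervalIntegrable (fun x ↦ u x * v' x) volume (n : ℝ) (n + 1) :=
    ((fun x hx ↦ (hderu x hx).continuousAt.continuousWithinAt) |> fun h ↦
      (ContinuousOn.mul h hcv').intervalIntegrable)
  rw [intervalIntegral.integral_add hint1 hint2, hu1, hu0] at hIBP
  -- replace `B_k(x - n)` by `B̄_k(x)` (they agree on `[n, n+1)`), similarly for `k+1`
  have hae : ∀ᵐ x : ℝ, x ∈ Ι (n : ℝ) (n + 1) →
      (bernoulliPer k x : ℂ) * (((x + a : ℝ)) : ℂ) ^ (-(s + k)) = u' x * v x := by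
    filter_upwards [ae_ne_real ((n : ℝ) + 1)] with x hx hmem
    rw [uIoc_of_le hle] at hmem
    have hIco : x ∈ Ico ((n : ℤ) : ℝ) ((n : ℤ) + 1) := by
      push_cast
      exact ⟨hmem.1.le, lt_of_le_of_ne hmem.2 hx⟩
    simp only [hu', hv, bernoulliPer_eq_of_mem_Ico k hIco]
    push_cast; ring_nf
  have hae' : ∀ᵐ x : ℝ, x ∈ Ι (n : ℝ) (n + 1) →
      u x * v' x = (-(s + k) / (k + 1)) *
        ((bernoulliPer (k + 1) x : ℂ) * (((x + a : ℝ)) : ℂ) ^ (-(s + k + 1))) := by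
    filter_upwards [ae_ne_real ((n : ℝ) + 1)] with x hx hmem
    rw [uIoc_of_le hle] at hmem
    have hIco : x ∈ Ico ((n : ℤ) : ℝ) ((n : ℤ) + 1) := by
      push_cast
      exact ⟨hmem.1.le, lt_of_le_of_ne hmem.2 hx⟩
    simp only [hu, hv', bernoulliPer_eq_of_mem_Ico (k + 1) hIco]
    push_cast
    field_simp
  have hI1 : ∫ x in (n : ℝ)..(n + 1), (bernoulliPer k x : ℂ) * (((x + a : ℝ)) : ℂ) ^ (-(s + k)) =
      ∫ x in (n : ℝ)..(n + 1), u' x * v x := integral_congr_ae hae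
  have hI2 : ∫ x in (n : ℝ)..(n + 1), u x * v' x = (-(s + k) / (k + 1)) *
      ∫ x in (n : ℝ)..(n + 1), (bernoulliPer (k + 1) x : ℂ) *
        (((x + a : ℝ)) : ℂ) ^ (-(s + k + 1)) := by
    rw [← intervalIntegral.integral_const_mul]
    exact integral_congr_ae hae'
  rw [hI1]
  have hv1 : v ((n : ℝ) + 1) = (((n + 1 + a : ℝ)) : ℂ) ^ (-(s + k)) := rfl
  have hv0 : v (n : ℝ) = (((n + a : ℝ)) : ℂ) ^ (-(s + k)) := rfl
  rw [hI2, hv1, hv0] at hIBP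
  linear_combination hIBP

/-- Interval integrability of `B̄_k(x) (x+a)^{-(s+k)}` on `[b, c] ⊂ [N, ∞)` (`Re s > 1 - k`,
`N ≥ 1`, `0 ≤ a ≤ 1`). [folklore] -/
private lemma intervalIntegrable_integrand {k N : ℕ} (hN : 1 ≤ N) {a : ℝ} (ha : 0 ≤ a) (ha1 : a ≤ 1)
    {s : ℂ} (hs : 1 - (k : ℝ) < s.re) {b c : ℝ} (hb : (N : ℝ) ≤ b) (hbc : b ≤ c) :
    IntervalIntegrable (fun x : ℝ ↦ (bernoulliPer k x : ℂ) * (((x + a : ℝ)) : ℂ) ^ (-(s + k)))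
      volume b c := by
  rw [intervalIntegrable_iff_integrableOn_Ioc_of_le hbc]
  exact (integrableOn_integrand hN ha ha1 (by simpa using hs)).mono_set
    (Ioc_subset_Ioi_self.trans (Ioi_subset_Ioi hb))

/-- Summing the unit-interval identity: for `1 ≤ N ≤ M`,
`∫_N^M B̄_k (x+a)^{-(s+k)} = (B_{k+1}/(k+1)) ((M+a)^{-(s+k)} - (N+a)^{-(s+k)})`
`+ ((s+k)/(k+1)) ∫_N^M B̄_{k+1} (x+a)^{-(s+k+1)}`. [cite: Edwards1974, §6.4 eq. (1)] -/
theorem intervalIntegral_eq {k N M : ℕ} (hk : 1 ≤ k) (hN : 1 ≤ N) (hNM : N ≤ M) {a : ℝ}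
    (ha : 0 ≤ a) (ha1 : a ≤ 1) {s : ℂ} (hs : 1 - (k : ℝ) < s.re) :
    ∫ x in (N : ℝ)..M, (bernoulliPer k x : ℂ) * (((x + a : ℝ)) : ℂ) ^ (-(s + k)) =
      (bernoulli (k + 1) : ℂ) / (k + 1) *
          ((((M + a : ℝ)) : ℂ) ^ (-(s + k)) - (((N + a : ℝ)) : ℂ) ^ (-(s + k))) +
        (s + k) / (k + 1) *
          ∫ x in (N : ℝ)..M, (bernoulliPer (k + 1) x : ℂ) *
            (((x + a : ℝ)) : ℂ) ^ (-(s + k + 1)) := by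
  obtain ⟨L, rfl⟩ : ∃ L, M = N + L := ⟨M - N, by omega⟩
  have hs' : 1 - ((k + 1 : ℕ) : ℝ) < s.re := by push_cast; linarith
  have hII : ∀ {b c : ℝ}, (N : ℝ) ≤ b → b ≤ c → IntervalIntegrable
      (fun x : ℝ ↦ (bernoulliPer (k + 1) x : ℂ) * (((x + a : ℝ)) : ℂ) ^ (-(s + k + 1)))
        volume b c := by
    intro b c hb hbc
    have := intervalIntegrable_integrand (k := k + 1) hN ha ha1 hs' hb hbc
    convert this using 4
    push_cast; ring
  clear hNM
  induction L with
  | zero => simp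
  | succ L ih =>
    have hNL : N ≤ N + L := Nat.le_add_right N L
    have h1 : (N : ℝ) ≤ (N + L : ℕ) := by exact_mod_cast hNL
    have h2 : ((N + L : ℕ) : ℝ) ≤ (N + (L + 1) : ℕ) := by push_cast; linarith
    have hunit := intervalIntegral_unit hk (le_trans hN hNL) ha s
    have hcast : ((N + (L + 1) : ℕ) : ℝ) = ((N + L : ℕ) : ℝ) + 1 := by push_cast; ring
    have eA := (intervalIntegral.integral_add_adjacent_intervals
        (intervalIntegrable_integrand hN ha ha1 hs le_rfl h1)
        (intervalIntegrable_integrand hN ha ha1 hs h1 h2)).symm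
    have eB := (intervalIntegral.integral_add_adjacent_intervals (hII le_rfl h1) (hII h1 h2)).symm
    rw [eA, eB, ih, hcast, hunit]
    ring

/-- `(M+a)^{-w} → 0` as `M → ∞` through the naturals, when `Re w > 0` (`a ≥ 0`). [folklore] -/
private lemma tendsto_natCast_add_cpow_neg {w : ℂ} (h : 0 < w.re) {a : ℝ} (ha : 0 ≤ a) :
    Tendsto (fun M : ℕ ↦ (((M + a : ℝ)) : ℂ) ^ (-w)) atTop (𝓝 0) := by
  rw [tendsto_zero_iff_norm_tendsto_zero]
  have h0 : Tendsto (fun M : ℕ ↦ ((M : ℝ) + a)) atTop atTop :=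
    tendsto_atTop_add_const_right _ _ tendsto_natCast_atTop_atTop
  have h1 : Tendsto (fun M : ℕ ↦ ((M : ℝ) + a) ^ (-w.re)) atTop (𝓝 0) :=
    (tendsto_rpow_neg_atTop h).comp h0
  refine h1.congr' ?_
  filter_upwards [eventually_gt_atTop 0] with M hM
  have hMa : 0 < (M : ℝ) + a := by positivity
  rw [Complex.norm_cpow_eq_rpow_re_of_pos hMa]
  simp

/-- **The integration-by-parts recursion for the remainder integrals**: for `k ≥ 1`, `N ≥ 1`,
`0 ≤ a ≤ 1`, `Re s > 1 - k`,
`∫_N^∞ B̄_k (x+a)^{-(s+k)} dx = -B_{k+1} (N+a)^{-(s+k)}/(k+1) + ((s+k)/(k+1)) ∫_N^∞ B̄_{k+1} (x+a)^{-(s+k+1)} dx`.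
[cite: Edwards1974, §6.4 eq. (1)] -/
theorem integral_eq_succ {k N : ℕ} (hk : 1 ≤ k) (hN : 1 ≤ N) {a : ℝ} (ha : 0 ≤ a) (ha1 : a ≤ 1)
    {s : ℂ} (hs : 1 - (k : ℝ) < s.re) :
    integral k N a s = -(bernoulli (k + 1) : ℂ) / (k + 1) * (((N + a : ℝ)) : ℂ) ^ (-(s + k)) +
      (s + k) / (k + 1) * integral (k + 1) N a s := by
  have hs' : 1 - ((k + 1 : ℕ) : ℝ) < s.re := by push_cast; linarith
  have hlim1 : Tendsto (fun M : ℕ ↦ ∫ x in (N : ℝ)..(M : ℝ),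
      (bernoulliPer k x : ℂ) * (((x + a : ℝ)) : ℂ) ^ (-(s + k))) atTop (𝓝 (integral k N a s)) :=
    intervalIntegral_tendsto_integral_Ioi (N : ℝ) (integrableOn_integrand hN ha ha1 (by simpa using hs))
      tendsto_natCast_atTop_atTop
  have hlim2 : Tendsto (fun M : ℕ ↦ ∫ x in (N : ℝ)..(M : ℝ),
      (bernoulliPer (k + 1) x : ℂ) * (((x + a : ℝ)) : ℂ) ^ (-(s + k + 1))) atTop
      (𝓝 (integral (k + 1) N a s)) := by
    have := intervalIntegral_tendsto_integral_Ioi (N : ℝ)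
      (integrableOn_integrand (k := k + 1) hN ha ha1 hs') tendsto_natCast_atTop_atTop
    unfold integral
    push_cast at this ⊢
    simpa [add_assoc] using this
  have hlim3 : Tendsto (fun M : ℕ ↦ (((M + a : ℝ)) : ℂ) ^ (-(s + k))) atTop (𝓝 0) :=
    tendsto_natCast_add_cpow_neg (by simp; linarith) ha
  have heq : ∀ᶠ M : ℕ in atTop,
      ∫ x in (N : ℝ)..(M : ℝ), (bernoulliPer k x : ℂ) * (((x + a : ℝ)) : ℂ) ^ (-(s + k)) =
        (bernoulli (k + 1) : ℂ) / (k + 1) *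
            ((((M + a : ℝ)) : ℂ) ^ (-(s + k)) - (((N + a : ℝ)) : ℂ) ^ (-(s + k))) +
          (s + k) / (k + 1) *
            ∫ x in (N : ℝ)..M, (bernoulliPer (k + 1) x : ℂ) *
              (((x + a : ℝ)) : ℂ) ^ (-(s + k + 1)) := by
    filter_upwards [eventually_ge_atTop N] with M hM
    exact intervalIntegral_eq hk hN hM ha ha1 hs
  have hlim4 := ((hlim3.sub_const ((((N + a : ℝ)) : ℂ) ^ (-(s + k)))).const_mul
    ((bernoulli (k + 1) : ℂ) / (k + 1))).add (hlim2.const_mul ((s + k) / (k + 1)))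
  have := tendsto_nhds_unique (hlim1.congr' heq) hlim4
  rw [this]
  ring


/-! ## §3 Order zero on `Re s > 1` from the Dirichlet series -/

/-- The elementary integral `∫_n^{n+1} B̄₁(x) (x+a)^{-s-1} dx = [ (x+a)^{1-s}/(1-s) + (n+a+½)(x+a)^{-s}/s ]_n^{n+1}`
(`s ≠ 0, 1`, `n ≥ 1`, `a ≥ 0`; on `[n, n+1)`, `B̄₁(x) = x - n - ½ = (x+a) - (n+a+½)`). [folklore] -/
private lemma intervalIntegral_one_unit {n : ℕ} (hn : 1 ≤ n) {a : ℝ} (ha : 0 ≤ a) {s : ℂ} (hs0 : s ≠ 0)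
    (hs1 : s ≠ 1) :
    ∫ x in (n : ℝ)..(n + 1), (bernoulliPer 1 x : ℂ) * (((x + a : ℝ)) : ℂ) ^ (-(s + 1)) =
      (((((n + 1 + a : ℝ)) : ℂ) ^ (1 - s) / (1 - s) +
          ((((n + a : ℝ)) : ℂ) + 1 / 2) * (((n + 1 + a : ℝ)) : ℂ) ^ (-s) / s) -
        ((((n + a : ℝ)) : ℂ) ^ (1 - s) / (1 - s) +
          ((((n + a : ℝ)) : ℂ) + 1 / 2) * (((n + a : ℝ)) : ℂ) ^ (-s) / s)) := by
  have hn0 : (0 : ℝ) < n := by exact_mod_cast hn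
  have hle : (n : ℝ) ≤ n + 1 := by linarith
  have h1s : (1 : ℂ) - s ≠ 0 := sub_ne_zero.2 (Ne.symm hs1)
  set c : ℂ := (((n + a : ℝ)) : ℂ) + 1 / 2 with hc
  set F : ℝ → ℂ := fun x ↦ (((x + a : ℝ)) : ℂ) ^ (1 - s) / (1 - s) +
    c * (((x + a : ℝ)) : ℂ) ^ (-s) / s with hF
  set g : ℝ → ℂ := fun x ↦ ((((x + a : ℝ)) : ℂ) - c) * (((x + a : ℝ)) : ℂ) ^ (-(s + 1)) with hg
  have hderiv : ∀ x ∈ uIcc (n : ℝ) (n + 1), HasDerivAt F (g x) x := by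
    intro x hx
    rw [uIcc_of_le hle] at hx
    have hx0 : 0 < x + a := by linarith [lt_of_lt_of_le hn0 hx.1]
    have hx' : (((x + a : ℝ)) : ℂ) ≠ 0 := ofReal_ne_zero.2 hx0.ne'
    have hA := (hasDerivAt_ofReal_add_cpow hx0 (1 - s)).div_const (1 - s)
    have hB := ((hasDerivAt_ofReal_add_cpow hx0 (-s)).const_mul c).div_const s
    refine (hA.add hB).congr_deriv ?_
    have hpow1 : (((x + a : ℝ)) : ℂ) ^ (1 - s - 1) =
        (((x + a : ℝ)) : ℂ) * (((x + a : ℝ)) : ℂ) ^ (-(s + 1)) := by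
      rw [show (1 : ℂ) - s - 1 = -(s + 1) + 1 by ring, cpow_add _ _ hx', cpow_one]; ring
    have hpow2 : (((x + a : ℝ)) : ℂ) ^ (-s - 1) = (((x + a : ℝ)) : ℂ) ^ (-(s + 1)) := by ring_nf
    simp only [hg]
    rw [hpow1, hpow2]
    field_simp
    ring
  have hcont : ContinuousOn g (uIcc (n : ℝ) (n + 1)) := by
    intro x hx
    rw [uIcc_of_le hle] at hx
    have hx0 : 0 < x + a := by linarith [lt_of_lt_of_le hn0 hx.1]
    have hc1 : ContinuousAt (fun x : ℝ ↦ (((x + a : ℝ)) : ℂ)) x :=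
      (continuous_ofReal.comp (continuous_id.add continuous_const)).continuousAt
    exact ((hc1.sub continuousAt_const).mul
      (hasDerivAt_ofReal_add_cpow hx0 _).continuousAt).continuousWithinAt
  have hFTC := intervalIntegral.integral_eq_sub_of_hasDerivAt hderiv hcont.intervalIntegrable
  -- `B̄₁(x) (x+a)^{-s-1} = g(x)` a.e. on `(n, n+1]`
  have hae : ∀ᵐ x : ℝ, x ∈ Ι (n : ℝ) (n + 1) →
      (bernoulliPer 1 x : ℂ) * (((x + a : ℝ)) : ℂ) ^ (-(s + 1)) = g x := by
    filter_upwards [ae_ne_real ((n : ℝ) + 1)] with x hx hmem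
    rw [uIoc_of_le hle] at hmem
    have hIco : x ∈ Ico ((n : ℤ) : ℝ) ((n : ℤ) + 1) := by
      push_cast
      exact ⟨hmem.1.le, lt_of_le_of_ne hmem.2 hx⟩
    rw [bernoulliPer_eq_of_mem_Ico 1 hIco, bernoulliFun_one]
    simp only [hg, hc]
    push_cast
    ring
  rw [integral_congr_ae hae, hFTC]

/-- The order-zero Euler–Maclaurin identity on one unit interval (`n ≥ 1`, `a ≥ 0`, `s ≠ 0, 1`):
`(n+a)^{-s} = [(n+1+a)^{1-s} − (n+a)^{1-s}]/(1−s) + ½[(n+a)^{-s} − (n+1+a)^{-s}]`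
`− s ∫_n^{n+1} B̄₁(x) (x+a)^{-(s+1)} dx`. [cite: Edwards1974, §6.4 eq. (1)] -/
lemma cpow_eq_unit {n : ℕ} (hn : 1 ≤ n) {a : ℝ} (ha : 0 ≤ a) {s : ℂ} (hs0 : s ≠ 0)
    (hs1 : s ≠ 1) :
    (((n + a : ℝ)) : ℂ) ^ (-s) =
      ((((n + 1 + a : ℝ)) : ℂ) ^ (1 - s) - (((n + a : ℝ)) : ℂ) ^ (1 - s)) / (1 - s) +
        ((((n + a : ℝ)) : ℂ) ^ (-s) - (((n + 1 + a : ℝ)) : ℂ) ^ (-s)) / 2 -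
          s * ∫ x in (n : ℝ)..(n + 1), (bernoulliPer 1 x : ℂ) * (((x + a : ℝ)) : ℂ) ^ (-(s + 1)) := by
  rw [intervalIntegral_one_unit hn ha hs0 hs1]
  have hn0 : (0 : ℝ) < n := by exact_mod_cast hn
  have hP0 : (((n + a : ℝ)) : ℂ) ≠ 0 := ofReal_ne_zero.2 (by linarith)
  have hQ0 : (((n + 1 + a : ℝ)) : ℂ) ≠ 0 := ofReal_ne_zero.2 (by linarith)
  have hP : (((n + a : ℝ)) : ℂ) ^ (1 - s) = (((n + a : ℝ)) : ℂ) * (((n + a : ℝ)) : ℂ) ^ (-s) := by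
    rw [show (1 : ℂ) - s = -s + 1 by ring, cpow_add _ _ hP0, cpow_one]; ring
  have hQ : (((n + 1 + a : ℝ)) : ℂ) ^ (1 - s) =
      (((n + 1 + a : ℝ)) : ℂ) * (((n + 1 + a : ℝ)) : ℂ) ^ (-s) := by
    rw [show (1 : ℂ) - s = -s + 1 by ring, cpow_add _ _ hQ0, cpow_one]; ring
  have h1s : (1 : ℂ) - s ≠ 0 := sub_ne_zero.2 (Ne.symm hs1)
  rw [hP, hQ]
  have hQP : (((n + 1 + a : ℝ)) : ℂ) = (((n + a : ℝ)) : ℂ) + 1 := by push_cast; ring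
  rw [hQP]
  field_simp
  ring

/-- The order-zero identity summed over `[N, M)` (`1 ≤ N ≤ M`, `0 < a ≤ 1`, `Re s > 0`, `s ≠ 1`):
`Σ_{n=N}^{M-1} (n+a)^{-s} = [(M+a)^{1-s} − (N+a)^{1-s}]/(1−s) + ½[(N+a)^{-s} − (M+a)^{-s}]`
`− s ∫_N^M B̄₁(x) (x+a)^{-(s+1)} dx`. [cite: Edwards1974, §6.4 eq. (1)] -/
lemma sum_Ico_cpow_eq {N M : ℕ} (hN : 1 ≤ N) (hNM : N ≤ M) {a : ℝ} (ha : 0 < a) (ha1 : a ≤ 1)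
    {s : ℂ} (hs : 0 < s.re) (hs1 : s ≠ 1) :
    ∑ n ∈ Finset.Ico N M, (((n + a : ℝ)) : ℂ) ^ (-s) =
      ((((M + a : ℝ)) : ℂ) ^ (1 - s) - (((N + a : ℝ)) : ℂ) ^ (1 - s)) / (1 - s) +
        ((((N + a : ℝ)) : ℂ) ^ (-s) - (((M + a : ℝ)) : ℂ) ^ (-s)) / 2 -
          s * ∫ x in (N : ℝ)..M, (bernoulliPer 1 x : ℂ) * (((x + a : ℝ)) : ℂ) ^ (-(s + 1)) := by
  have hs0 : s ≠ 0 := fun h ↦ by rw [h] at hs; simp at hs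
  have hk : 1 - ((1 : ℕ) : ℝ) < s.re := by push_cast; linarith
  obtain ⟨L, rfl⟩ : ∃ L, M = N + L := ⟨M - N, by omega⟩
  clear hNM
  induction L with
  | zero => simp
  | succ L ih =>
    have hNL : N ≤ N + L := Nat.le_add_right N L
    have h1 : (N : ℝ) ≤ (N + L : ℕ) := by exact_mod_cast hNL
    have h2 : ((N + L : ℕ) : ℝ) ≤ ((N + L : ℕ) : ℝ) + 1 := by linarith
    rw [show N + (L + 1) = (N + L) + 1 by ring, Finset.sum_Ico_succ_top hNL, ih]
    have hu := cpow_eq_unit (n := N + L) (le_trans hN hNL) ha.le hs0 hs1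
    have eA := (intervalIntegral.integral_add_adjacent_intervals
        (intervalIntegrable_integrand (k := 1) hN ha.le ha1 hk le_rfl h1)
        (intervalIntegrable_integrand (k := 1) hN ha.le ha1 hk h1 h2)).symm
    push_cast at hu eA ⊢
    linear_combination hu + s * eA

/-- **Euler–Maclaurin of order zero for `ζ(s, a)` on `Re s > 1`** (`N ≥ 1`, `0 < a ≤ 1`):
`ζ(s,a) = Σ_{n<N} (n+a)^{-s} + (N+a)^{1-s}/(s-1) + ½(N+a)^{-s} − s ∫_N^∞ B̄₁(x)(x+a)^{-s-1} dx`,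
from the Dirichlet series `HurwitzZeta.hasSum_hurwitzZeta_of_one_lt_re` by letting `M → ∞` in
`sum_Ico_cpow_eq`. [cite: Edwards1974, §6.4 eq. (1)] -/
theorem hurwitzZeta_eq_eulerMaclaurin₀_of_one_lt_re {N : ℕ} (hN : 1 ≤ N) {a : ℝ} (ha : 0 < a)
    (ha1 : a ≤ 1) {s : ℂ} (hs : 1 < s.re) :
    HurwitzZeta.hurwitzZeta (a : UnitAddCircle) s =
      ∑ n ∈ Finset.range N, (((n + a : ℝ)) : ℂ) ^ (-s) +
        (((N + a : ℝ)) : ℂ) ^ (1 - s) / (s - 1) + (((N + a : ℝ)) : ℂ) ^ (-s) / 2 -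
          s * integral 1 N a s := by
  have hs0 : 0 < s.re := by linarith
  have hs1 : s ≠ 1 := fun h ↦ by rw [h] at hs; simp at hs
  have hk : 1 - ((1 : ℕ) : ℝ) < s.re := by push_cast; linarith
  -- the Dirichlet series
  have hser := HurwitzZeta.hasSum_hurwitzZeta_of_one_lt_re ⟨ha.le, ha1⟩ hs
  have hterm : ∀ n : ℕ, 1 / ((n : ℂ) + a) ^ s = (((n + a : ℝ)) : ℂ) ^ (-s) := by
    intro n
    rw [cpow_neg, one_div]
    push_cast
    rfl
  simp_rw [hterm] at hser
  have hlimS : Tendsto (fun M : ℕ ↦ ∑ n ∈ Finset.Ico N M, (((n + a : ℝ)) : ℂ) ^ (-s)) atTop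
      (𝓝 (HurwitzZeta.hurwitzZeta (a : UnitAddCircle) s -
        ∑ n ∈ Finset.range N, (((n + a : ℝ)) : ℂ) ^ (-s))) := by
    have h := (hser.tendsto_sum_nat).sub_const (∑ n ∈ Finset.range N, (((n + a : ℝ)) : ℂ) ^ (-s))
    refine h.congr' ?_
    filter_upwards [eventually_ge_atTop N] with M hM
    rw [Finset.sum_Ico_eq_sub _ hM]
  -- the limits of the right-hand side
  have hlim1 : Tendsto (fun M : ℕ ↦ (((M + a : ℝ)) : ℂ) ^ (1 - s)) atTop (𝓝 0) := by
    have := tendsto_natCast_add_cpow_neg (w := s - 1) (by simp; linarith) ha.le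
    simpa [neg_sub] using this
  have hlim2 : Tendsto (fun M : ℕ ↦ (((M + a : ℝ)) : ℂ) ^ (-s)) atTop (𝓝 0) :=
    tendsto_natCast_add_cpow_neg hs0 ha.le
  have hlim3 : Tendsto (fun M : ℕ ↦ ∫ x in (N : ℝ)..(M : ℝ),
      (bernoulliPer 1 x : ℂ) * (((x + a : ℝ)) : ℂ) ^ (-(s + 1))) atTop (𝓝 (integral 1 N a s)) := by
    have := intervalIntegral_tendsto_integral_Ioi (N : ℝ)
      (integrableOn_integrand (k := 1) hN ha.le ha1 hk) tendsto_natCast_atTop_atTop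
    unfold integral
    push_cast at this ⊢
    exact this
  have heq : ∀ᶠ M : ℕ in atTop, ∑ n ∈ Finset.Ico N M, (((n + a : ℝ)) : ℂ) ^ (-s) =
      ((((M + a : ℝ)) : ℂ) ^ (1 - s) - (((N + a : ℝ)) : ℂ) ^ (1 - s)) / (1 - s) +
        ((((N + a : ℝ)) : ℂ) ^ (-s) - (((M + a : ℝ)) : ℂ) ^ (-s)) / 2 -
          s * ∫ x in (N : ℝ)..M, (bernoulliPer 1 x : ℂ) * (((x + a : ℝ)) : ℂ) ^ (-(s + 1)) := by
    filter_upwards [eventually_ge_atTop N] with M hM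
    exact sum_Ico_cpow_eq hN hM ha ha1 hs0 hs1
  have hlim4 := (((hlim1.sub_const ((((N + a : ℝ)) : ℂ) ^ (1 - s))).div_const (1 - s)).add
    ((hlim2.const_sub ((((N + a : ℝ)) : ℂ) ^ (-s))).div_const 2)).sub (hlim3.const_mul s)
  have huniq := tendsto_nhds_unique (hlimS.congr' heq) hlim4
  have h1s : (1 : ℂ) - s ≠ 0 := sub_ne_zero.2 (Ne.symm hs1)
  have hs1' : s - 1 ≠ 0 := sub_ne_zero.2 hs1
  rw [sub_eq_iff_eq_add] at huniq
  rw [huniq]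
  field_simp
  ring

/-! ## §4 Continuation to `Re s > 0` -/

/-- **Euler–Maclaurin of order zero for `ζ(s, a)` on `Re s > 0`** (`s ≠ 1`, `N ≥ 1`,
`0 < a ≤ 1`): `ζ(s,a) = Σ_{n<N} (n+a)^{-s} + (N+a)^{1-s}/(s-1) + ½(N+a)^{-s} − s ∫_N^∞ B̄₁(x)(x+a)^{-s-1} dx`.
Proof: the entire function `s ↦ (s−1)(ζ(s,a) − 1/((s−1)Γ_ℝ(s))) + 1/Γ_ℝ(s)` (Mathlib's
`HurwitzZeta.differentiableAt_hurwitzZeta_sub_one_div`, `Complex.differentiable_Gammaℝ_inv`), equal to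
`(s−1)ζ(s,a)` off `s = 1`, agrees on `Re s > 1` with the holomorphic function
`(s−1)(Σ + ½(N+a)^{-s} − s J₁) + (N+a)^{1-s}` on the convex half-plane `Re s > 0`
(`differentiableOn_integral`); identity theorem. [cite: Edwards1974, §6.4 eq. (1)] -/
theorem hurwitzZeta_eq_eulerMaclaurin₀ {N : ℕ} (hN : 1 ≤ N) {a : ℝ} (ha : 0 < a) (ha1 : a ≤ 1)
    {s : ℂ} (hs : 0 < s.re) (hs1 : s ≠ 1) :
    HurwitzZeta.hurwitzZeta (a : UnitAddCircle) s =
      ∑ n ∈ Finset.range N, (((n + a : ℝ)) : ℂ) ^ (-s) +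
        (((N + a : ℝ)) : ℂ) ^ (1 - s) / (s - 1) + (((N + a : ℝ)) : ℂ) ^ (-s) / 2 -
          s * integral 1 N a s := by
  set U : Set ℂ := {s : ℂ | 0 < s.re} with hU
  have hUo : IsOpen U := isOpen_lt continuous_const continuous_re
  have hUc : IsPreconnected U := (convex_halfSpace_re_gt 0).isPreconnected
  -- the entire function `P(s) = (s-1)(ζ(s,a) - 1/((s-1)Γℝ(s))) + 1/Γℝ(s)`
  set E : ℂ → ℂ := fun z ↦ HurwitzZeta.hurwitzZeta (a : UnitAddCircle) z - 1 / (z - 1) / Gammaℝ z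
    with hE
  have hEd : Differentiable ℂ E := by
    intro z
    by_cases hz : z = 1
    · subst hz
      exact HurwitzZeta.differentiableAt_hurwitzZeta_sub_one_div _
    · have h1 : DifferentiableAt ℂ (fun z : ℂ ↦ 1 / (z - 1) / Gammaℝ z) z := by
        have hA : DifferentiableAt ℂ (fun z : ℂ ↦ 1 / (z - 1)) z :=
          (differentiableAt_const _).div ((differentiableAt_id).sub_const 1) (sub_ne_zero.2 hz)
        have hB : DifferentiableAt ℂ (fun z : ℂ ↦ (Gammaℝ z)⁻¹) z :=
          differentiable_Gammaℝ_inv.differentiableAt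
        have h := DifferentiableAt.mul hA hB
        have heq : (fun z : ℂ ↦ 1 / (z - 1) / Gammaℝ z) =
            (fun z : ℂ ↦ 1 / (z - 1)) * (fun z : ℂ ↦ (Gammaℝ z)⁻¹) := by
          funext z
          simp only [Pi.mul_apply, div_eq_mul_inv]
        rw [heq]
        exact h
      exact (HurwitzZeta.differentiableAt_hurwitzZeta _ hz).sub h1
  set P : ℂ → ℂ := fun z ↦ (z - 1) * E z + (Gammaℝ z)⁻¹ with hP
  have hPd : Differentiable ℂ P :=
    ((differentiable_id.sub_const 1).mul hEd).add differentiable_Gammaℝ_inv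
  have hPval : ∀ z : ℂ, z ≠ 1 → P z = (z - 1) * HurwitzZeta.hurwitzZeta (a : UnitAddCircle) z := by
    intro z hz
    have hz' : z - 1 ≠ 0 := sub_ne_zero.2 hz
    simp only [hP, hE]
    field_simp
    ring
  -- the holomorphic right-hand side `Q`
  set Q : ℂ → ℂ := fun z ↦ (z - 1) * (∑ n ∈ Finset.range N, (((n + a : ℝ)) : ℂ) ^ (-z) +
      (((N + a : ℝ)) : ℂ) ^ (-z) / 2 - z * integral 1 N a z) + (((N + a : ℝ)) : ℂ) ^ (1 - z)
    with hQ
  have hNa : (((N + a : ℝ)) : ℂ) ≠ 0 := ofReal_ne_zero.2 (by positivity)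
  have hQd : DifferentiableOn ℂ Q U := by
    have hS : DifferentiableOn ℂ (fun z : ℂ ↦ ∑ n ∈ Finset.range N, (((n + a : ℝ)) : ℂ) ^ (-z)) U := by
      refine DifferentiableOn.fun_sum fun n _ ↦ ?_
      have hn : (((n + a : ℝ)) : ℂ) ≠ 0 := ofReal_ne_zero.2 (by positivity)
      exact (differentiableOn_id.neg.const_cpow (Or.inl hn))
    have hX : DifferentiableOn ℂ (fun z : ℂ ↦ (((N + a : ℝ)) : ℂ) ^ (-z) / 2) U :=
      (differentiableOn_id.neg.const_cpow (Or.inl hNa)).div_const 2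
    have hX' : DifferentiableOn ℂ (fun z : ℂ ↦ (((N + a : ℝ)) : ℂ) ^ (1 - z)) U :=
      ((differentiableOn_const (1 : ℂ)).sub differentiableOn_id).const_cpow (Or.inl hNa)
    have hJ : DifferentiableOn ℂ (fun z : ℂ ↦ z * integral 1 N a z) U := by
      refine differentiableOn_id.mul ?_
      have := differentiableOn_integral (k := 1) (N := N) hN ha.le ha1
      refine this.mono fun z hz ↦ ?_
      simp only [Set.mem_setOf_eq, Nat.cast_one, sub_self]
      exact hz
    exact (((differentiableOn_id.sub_const 1).mul ((hS.add hX).sub hJ)).add hX')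
  have hPa : AnalyticOnNhd ℂ P U := hPd.differentiableOn.analyticOnNhd hUo
  have hQa : AnalyticOnNhd ℂ Q U := hQd.analyticOnNhd hUo
  -- agreement on `Re s > 1`
  have h2 : (2 : ℂ) ∈ U := by simp [hU]
  have hPQ : P =ᶠ[𝓝 (2 : ℂ)] Q := by
    have hmem : {z : ℂ | 1 < z.re} ∈ 𝓝 (2 : ℂ) :=
      (isOpen_lt continuous_const continuous_re).mem_nhds (by simp)
    filter_upwards [hmem] with z hz
    have hz1 : z ≠ 1 := fun h ↦ by rw [h] at hz; simp at hz
    have hz1' : z - 1 ≠ 0 := sub_ne_zero.2 hz1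
    rw [hPval z hz1, hurwitzZeta_eq_eulerMaclaurin₀_of_one_lt_re hN ha ha1 hz]
    simp only [hQ]
    field_simp
    ring
  have hEq := hPa.eqOn_of_preconnected_of_eventuallyEq hQa hUc h2 hPQ hs
  rw [hPval s hs1] at hEq
  have hs1' : s - 1 ≠ 0 := sub_ne_zero.2 hs1
  have : HurwitzZeta.hurwitzZeta (a : UnitAddCircle) s = Q s / (s - 1) := by
    rw [← hEq]; field_simp
  rw [this]
  simp only [hQ]
  field_simp
  ring

end HurwitzEM

/-! ## §5 The formula of order `ν` and the remainder bound -/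

/-- The order-zero main term for `ζ(s, a)`:
`Σ_{n<N} (n+a)^{-s} + (N+a)^{1-s}/(s-1) + ½ (N+a)^{-s}`. [cite: Edwards1974, §6.4 eq. (1)] -/
def hurwitzEmMainZero (N : ℕ) (a : ℝ) (s : ℂ) : ℂ :=
  ∑ n ∈ Finset.range N, (((n + a : ℝ)) : ℂ) ^ (-s) +
    (((N + a : ℝ)) : ℂ) ^ (1 - s) / (s - 1) + (((N + a : ℝ)) : ℂ) ^ (-s) / 2

/-- The `k`-th Euler–Maclaurin correction term for `ζ(s, a)`:
`T_k(s, a) = (B_{2k}/(2k)!) · s(s+1)⋯(s+2k-2) · (N+a)^{-(s+2k-1)}` (`k ≥ 1`).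
[cite: Edwards1974, §6.4 eq. (1)] -/
def hurwitzEmTerm (N : ℕ) (a : ℝ) (s : ℂ) (k : ℕ) : ℂ :=
  (bernoulli (2 * k) : ℂ) / (2 * k).factorial * emPoch s (2 * k - 1) *
    (((N + a : ℝ)) : ℂ) ^ (-(s + ((2 * k - 1 : ℕ) : ℂ)))

/-- The Euler–Maclaurin remainder of order `ν` for `ζ(s, a)`:
`R_ν(s, a) = -(s(s+1)⋯(s+2ν)/(2ν+1)!) ∫_N^∞ B̄_{2ν+1}(x) (x+a)^{-(s+2ν+1)} dx`.
[cite: Edwards1974, §6.4 eq. (1)] -/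
def hurwitzEmRem (N ν : ℕ) (a : ℝ) (s : ℂ) : ℂ :=
  -(emPoch s (2 * ν + 1) / (2 * ν + 1).factorial) * HurwitzEM.integral (2 * ν + 1) N a s

/-- One step of the recursion: `R_ν = T_{ν+1} + R_{ν+1}` on `Re s > 0` (`N ≥ 1`, `0 < a ≤ 1`).
[cite: Edwards1974, §6.4 eq. (1)] -/
theorem hurwitzEmRem_eq_succ {N : ℕ} (hN : 1 ≤ N) {a : ℝ} (ha : 0 < a) (ha1 : a ≤ 1) {s : ℂ}
    (hs : 0 < s.re) (ν : ℕ) :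
    hurwitzEmRem N ν a s = hurwitzEmTerm N a s (ν + 1) + hurwitzEmRem N (ν + 1) a s := by
  have hJ1 := HurwitzEM.integral_eq_succ (k := 2 * ν + 1) (by omega) hN ha.le ha1 (s := s)
    (by push_cast; linarith)
  have hJ2 := HurwitzEM.integral_eq_succ (k := 2 * ν + 1 + 1) (by omega) hN ha.le ha1 (s := s)
    (by push_cast; linarith)
  have hB : (bernoulli (2 * ν + 1 + 1 + 1) : ℂ) = 0 := by
    rw [show 2 * ν + 1 + 1 + 1 = 2 * ν + 3 by ring, bernoulli_two_mul_add_three]; simp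
  have e1 : 2 * (ν + 1) - 1 = 2 * ν + 1 := by omega
  have e2 : 2 * (ν + 1) = 2 * ν + 1 + 1 := by ring
  rw [hurwitzEmRem, hurwitzEmRem, hurwitzEmTerm, e1, e2, hJ1, hJ2, hB]
  rw [emPoch_succ s (2 * ν + 1 + 1), emPoch_succ s (2 * ν + 1),
    Nat.factorial_succ (2 * ν + 1 + 1), Nat.factorial_succ (2 * ν + 1)]
  have hf : ((2 * ν + 1).factorial : ℂ) ≠ 0 := by exact_mod_cast (Nat.factorial_pos _).ne'
  have h1 : (2 * (ν : ℂ) + 1 + 1) ≠ 0 := by norm_cast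
  have h2 : (2 * (ν : ℂ) + 1 + 1 + 1) ≠ 0 := by norm_cast
  -- freeze the atoms
  generalize emPoch s (2 * ν + 1) = P
  generalize HurwitzEM.integral (2 * ν + 1 + 1 + 1) N a s = J
  generalize (((N + a : ℝ)) : ℂ) ^ (-(s + ((2 * ν + 1 : ℕ) : ℂ))) = X
  generalize (((N + a : ℝ)) : ℂ) ^ (-(s + ((2 * ν + 1 + 1 : ℕ) : ℂ))) = X'
  generalize ((2 * ν + 1).factorial : ℕ) = F at hf ⊢
  push_cast
  field_simp
  ring

/-- **Euler–Maclaurin summation of order `ν` for the Hurwitz zeta function on `Re s > 0`**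
(`s ≠ 1`, `N ≥ 1`, `0 < a ≤ 1`):
`ζ(s,a) = Σ_{n<N} (n+a)^{-s} + (N+a)^{1-s}/(s-1) + ½(N+a)^{-s} + Σ_{k=1}^{ν} T_k(s,a) + R_ν(s,a)`.
[cite: Edwards1974, §6.4 eq. (1)] -/
theorem hurwitzZeta_eq_eulerMaclaurin_of_re_pos {N : ℕ} (hN : 1 ≤ N) {a : ℝ} (ha : 0 < a)
    (ha1 : a ≤ 1) {s : ℂ} (hs : 0 < s.re) (hs1 : s ≠ 1) (ν : ℕ) :
    HurwitzZeta.hurwitzZeta (a : UnitAddCircle) s =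
      hurwitzEmMainZero N a s + ∑ k ∈ Finset.Icc 1 ν, hurwitzEmTerm N a s k +
        hurwitzEmRem N ν a s := by
  induction ν with
  | zero =>
    rw [HurwitzEM.hurwitzZeta_eq_eulerMaclaurin₀ hN ha ha1 hs hs1, hurwitzEmMainZero, hurwitzEmRem]
    simp [emPoch_one]
    ring
  | succ ν ih =>
    rw [ih, hurwitzEmRem_eq_succ hN ha ha1 hs ν, Finset.sum_Icc_succ_top (by omega)]
    ring

/-- **Remainder estimate of order `ν ≥ 1` on `Re s > 0`** (`N ≥ 1`, `0 < a ≤ 1`):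
`‖R_ν(s,a)‖ ≤ ‖s(s+1)⋯(s+2ν)‖ · (π²/3)(2π)^{-(2ν+1)} · N^{-(Re s + 2ν)} / (Re s + 2ν)` — the same
majorant as for `ζ` (`norm_emRemHigher_le`), since `(x+a)^{-σ} ≤ x^{-σ}`.
[cite: Edwards1974, §6.4 (estimate after eq. (1))] -/
theorem norm_hurwitzEmRem_le {N : ℕ} (hN : 1 ≤ N) {a : ℝ} (ha : 0 < a) {s : ℂ}
    (hs : 0 < s.re) {ν : ℕ} (hν : ν ≠ 0) :
    ‖hurwitzEmRem N ν a s‖ ≤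
      ‖emPoch s (2 * ν + 1)‖ * (Real.pi ^ 2 / 3 / (2 * Real.pi) ^ (2 * ν + 1)) *
        ((N : ℝ) ^ (-(s.re + 2 * ν)) / (s.re + 2 * ν)) := by
  set β : ℝ := Real.pi ^ 2 / 3 * ((2 * ν + 1).factorial : ℝ) / (2 * Real.pi) ^ (2 * ν + 1)
    with hβ
  have hβb : ∀ x, |bernoulliPer (2 * ν + 1) x| ≤ β := abs_bernoulliPer_odd_le hν
  have hk : 1 - ((2 * ν + 1 : ℕ) : ℝ) < s.re := by push_cast; linarith
  have hJ := HurwitzEM.norm_integral_le hβb hN ha.le hk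
  have hfac : (0 : ℝ) < (2 * ν + 1).factorial := by exact_mod_cast Nat.factorial_pos _
  have hσ : 0 < s.re + 2 * ν := by positivity
  have hN0 : (0 : ℝ) < N := by exact_mod_cast hN
  have e1 : s.re + ((2 * ν + 1 : ℕ) : ℝ) - 1 = s.re + 2 * ν := by push_cast; ring
  rw [e1] at hJ
  unfold hurwitzEmRem
  rw [norm_mul, norm_neg, norm_div, Complex.norm_natCast]
  have hP : 0 ≤ ‖emPoch s (2 * ν + 1)‖ := norm_nonneg _
  have hQ : 0 ≤ (N : ℝ) ^ (-(s.re + 2 * ν)) / (s.re + 2 * ν) :=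
    div_nonneg (Real.rpow_nonneg hN0.le _) hσ.le
  calc ‖emPoch s (2 * ν + 1)‖ / ((2 * ν + 1).factorial : ℝ) *
        ‖HurwitzEM.integral (2 * ν + 1) N a s‖
      ≤ ‖emPoch s (2 * ν + 1)‖ / ((2 * ν + 1).factorial : ℝ) *
          (β * ((N : ℝ) ^ (-(s.re + 2 * ν)) / (s.re + 2 * ν))) :=
        mul_le_mul_of_nonneg_left hJ (by positivity)
    _ = _ := by
        rw [hβ]
        field_simp

/-- The remainder bound with the rational majorant `(33/10) · (25/157)^{2ν+1}` of
`(π²/3)(2π)^{-(2ν+1)}` and `N^{-(Re s + 2ν)}/(Re s + 2ν) ≤ 1/(N^{2ν} · 2ν)` — literally the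
right-hand side of `norm_emRemHigher_le_rat`, the form consumed by the certified evaluator.
[cite: Edwards1974, §6.4 (estimate after eq. (1))] -/
theorem norm_hurwitzEmRem_le_rat {N : ℕ} (hN : 1 ≤ N) {a : ℝ} (ha : 0 < a) {s : ℂ}
    (hs : 0 < s.re) {ν : ℕ} (hν : ν ≠ 0) :
    ‖hurwitzEmRem N ν a s‖ ≤
      ‖emPoch s (2 * ν + 1)‖ * ((33 / 10 : ℝ) * (25 / 157) ^ (2 * ν + 1)) *
        (1 / ((N : ℝ) ^ (2 * ν) * (2 * ν))) := by
  refine (norm_hurwitzEmRem_le hN ha hs hν).trans ?_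
  have hN0 : (0 : ℝ) < N := by exact_mod_cast hN
  have hN1 : (1 : ℝ) ≤ N := by exact_mod_cast hN
  have hν0 : (0 : ℝ) < ν := by exact_mod_cast Nat.pos_of_ne_zero hν
  have hπ3 := Real.pi_gt_d2
  have hπ4 := Real.pi_lt_d4
  have h1 : Real.pi ^ 2 / 3 / (2 * Real.pi) ^ (2 * ν + 1) ≤
      (33 / 10 : ℝ) * (25 / 157) ^ (2 * ν + 1) := by
    rw [div_le_iff₀ (by positivity)]
    have hA : Real.pi ^ 2 / 3 ≤ 33 / 10 := by nlinarith
    have hB : (1 : ℝ) ≤ (25 / 157) ^ (2 * ν + 1) * (2 * Real.pi) ^ (2 * ν + 1) := by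
      rw [← mul_pow]
      exact one_le_pow₀ (by nlinarith)
    nlinarith
  have h2 : (N : ℝ) ^ (-(s.re + 2 * ν)) / (s.re + 2 * ν) ≤ 1 / ((N : ℝ) ^ (2 * ν) * (2 * ν)) := by
    rw [div_le_div_iff₀ (by positivity) (by positivity), one_mul]
    have hr : (N : ℝ) ^ (-(s.re + 2 * ν)) * (N : ℝ) ^ (2 * ν) ≤ 1 := by
      rw [← Real.rpow_natCast, ← Real.rpow_add hN0]
      push_cast
      rw [show -(s.re + 2 * ν) + 2 * (ν : ℝ) = -s.re by ring]
      exact Real.rpow_le_one_of_one_le_of_nonpos hN1 (by linarith)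
    have hpos : (0 : ℝ) ≤ (N : ℝ) ^ (-(s.re + 2 * ν)) := Real.rpow_nonneg hN0.le _
    calc (N : ℝ) ^ (-(s.re + 2 * ν)) * ((N : ℝ) ^ (2 * ν) * (2 * ν))
        = ((N : ℝ) ^ (-(s.re + 2 * ν)) * (N : ℝ) ^ (2 * ν)) * (2 * ν) := by ring
      _ ≤ 1 * (2 * ν) := by gcongr
      _ ≤ s.re + 2 * ν := by linarith
  have hP : 0 ≤ ‖emPoch s (2 * ν + 1)‖ := norm_nonneg _
  have hQ : 0 ≤ (N : ℝ) ^ (-(s.re + 2 * ν)) / (s.re + 2 * ν) :=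
    div_nonneg (Real.rpow_nonneg hN0.le _) (by positivity)
  exact mul_le_mul (mul_le_mul_of_nonneg_left h1 hP) h2 hQ (by positivity)

end Literature.NumberTheory.LFunctions
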